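import Summits.Ventures.CertifiedManyBodySolver.Theorems.M3x2EdgeSplitSymReplayShardsB
import Summits.Ventures.CertifiedManyBodySolver.Theorems.M3x2EdgeSplitSymReplayDecode
import HarnessLib

/-!
# SymReplay — ORBIT-REPRESENTATIVE Gram blocks («gramR»): syntax, kernel toy, and SOUNDNESS
(pen hub-lb-sym-plan-1 g2, 2026-08-28, rev 4; ADDITIVE module on the landed T1–T12b chain + `…SyntaxV` + `…Decode` — nothing of
`…SymReplaySyntax … SymReplaySound / ShardsA / ShardsB / SyntaxV / Decode` is touched; crit-1 V80 (B) / V83 additive + one-writer rules).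

THE LEVER (checker COST, not a bound lever).  A Gram block of the v0′ certificate lives in one isotypic
component of the window's point group `K` (`D₄` about the window centre for the 68 `A`-type blocks, `D₂` for the
17 `E`-type blocks); every basis polynomial is `q_i = Σ_{g ∈ K} χ(g) · α_g(s_i)` for a one-dimensional
character `χ` and a SHORT representative `s_i` (2 938 representative words for 17 045 basis words on v0′,
checked element-wise in the CAR algebra: STATUS l.1317).  Since `α_g(q_j) = χ(g) q_j`,
`q_i† q_j = Σ_g α_g(s_i† q_j)` EXACTLY, so the block `P = λ Σ g_ij q_i† q_j` equals `|K| · D` MODULO LICENSED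
MOVES, `D := λ Σ g_ij s_i† q_j` — and the checker expands only `D` (1 456 545 products instead of 8 418 173,
÷5.78).  Nothing about groups or characters is trusted: the checker GENERATES `q_j` from the shipped `s_j` and
VERIFIES the eigen-property `α_m(q_j) = χ_m q_j` syntactically for every shipped move `m`; a passing check is
sound unconditionally.

CONTENTS.  `SyntaxR` (computable; needs only T1 + `…SyntaxV`): `RMove`, `GramBlockR`, `movePolyF` (executed through
`moveWordV` — rev 4; see its docstring for the ×50 measurement),
`genPre/genOne/genBasis/toGramBlock`, `eigenOK`, `gramBlockROK`, `gramBlockPolyR`, `SymCertR` (= `SymCert` + `gramR`),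
`SymCertR.expand` (the ordinary certificate `K♯` with the generated blocks appended to `gramM` — never expanded by the
checker), `rhsPolyR`, `residualR`, `identityOKR`, `symCheckR`, `symValueR`; the EXECUTED variant `identityOKRV` /
`symCheckRV` (canonicaliser `canonTermAV` of the landed `…SyntaxV`, integer-pair corner) with `symCheckRV_eq :
symCheckRV K = symCheckR K` (V83 pattern); the kernel toy `toyRCert` (value `−11/4`, two one-column R-blocks) checked
by `decide +kernel` through both.  `SemanticsR` (all PROVED, farm rc 0 · 0 sorry · 0 warnings): the block lemma
`polyOp (gramBlockPoly (toGramBlock B)) = polyOp (|moves| • D_B) + Σ uses`, `polyOp_rhsPoly_expand`, and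
`symCheckR_sound : symCheckR K = true → WardD4CertGe (symValueR K)` — concluded by the LANDED expansion-form S4
`wardD4CertGe_of_expansion` (T12a `…ShardsA`, hub-lb-sym-eng-3; single-sourced, no copy here) with the DERIVED use family
`usesR K` — whence `energyDensity_ge_symValueR : symCheckR K = true → symValueR K ≤ e₀(1, 0, 8, 7/8)` (no hypothesis) and
the end-to-end toy `toyRCert_energy_ge : −11/4 ≤ e₀(1, 0, 8, 7/8)` (axioms `propext / Classical.choice / Quot.sound`).
`ShardsR` (§(g), all PROVED): T12b's sharded-replay contract (`…ShardsB`, hub-lb-sym-eng-3) with `rhsPoly ↦ rhsPolyR` —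
`shardPolysR K c := shardPolys K.toSymCert c ++ (R-block chunks by representatives)`, `sum_shardPolysR`, `shardOKR`/`ShardFactsR`
(T12b's `canonNF`, `Facts₂`, `facts₂_sum` reused verbatim), `wardD4CertGe_of_shardsR` / `energyDensity_ge_of_shardsR`, the executed
pipe `canonNFAV` (= `canonNF`, via `canonTermAV_eq`) with `shardOKRV`/`ShardFactsRV`/`energyDensity_ge_of_shardsRV`, and the toy
`toyRCert` replayed in three R-shards (`toyRCert_energy_ge_sharded`, `decide +kernel` only, standard axioms).
`DecodeR` (§(h), computable, rev 4): the R DATA PATH — token-string literals in the grammar of the landed `…Decode`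
(hub-lb-sym-eng-4) extended by `rblock := p q nM (k vx vy cp cq)ⁿᴹ nS polyⁿˢ nR rowⁿᴿ` and `gramR := n rblockⁿ`
(`d4OfNat k` = `k`-th entry of `d4All`, move = `⟨d4OfNat k, mkSite vx vy, cp/cq⟩`): `rdMoves`, `rdRBlock`, `rdRBlocks`,
`decodeGramR`, `decodeSymCertR ts tsR := { toSymCert := decodeSymCert ts, gramR := decodeGramR tsR }`, with a kernel
round-trip regression on `toyRCert.gramR`.  First REAL block measured on the farm (`mm.c0/22` of v0core, 35 136 products,
self-contained probe `ProbeC022_symplan1.lean`): decode + side conditions + generated-basis = shipped-basis + expansion to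
30 504 nonzero words in 15.9 s wall (one `lean check`).

HONEST FRAMING: a checker COST lever with its soundness theorem and a toy; no certificate beyond the toy is
replayed here; no bound of record moves; no summit or crux statement is proved here; nothing here predicts
superconductivity.
-/

namespace Summit.Ventures.CertifiedManyBodySolver.Theorems.SymReplay

open Literature.Probability.LatticeModels

section SyntaxR

/-- Letterwise move of every word of a polynomial — EXECUTED through `moveWordV` of `…SyntaxV` (every moved site rebuilt
from two computed integers; `moveWordV = moveWordF` is `rfl`).  Measured on the farm (block `mm.c0/22`, 3 904 moved
words against the 625-site frame): support checks of `moveWordF`-moved generated words 418 s vs 8 s with `moveWordV` —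
T1's `flatSite` does not cut the closure chain under compiled evaluation, every site access re-runs the move. -/
def movePolyF (γ : DihedralGroup 4) (v : Site 2) (p : QPoly) : QPoly := p.map fun t => (t.1, moveWordV γ v t.2)

theorem movePolyF_def (γ : DihedralGroup 4) (v : Site 2) (p : QPoly) :
    movePolyF γ v p = p.map fun t => (t.1, moveWordF γ v t.2) := rfl

/-- A block move: the affine `D₄` move `x ↦ γx + v` together with the character value `χ` it acts by on the block's
basis polynomials. -/
structure RMove where
  γ : DihedralGroup 4
  v : Site 2
  χ : ℚ

/-- **Orbit-representative Gram block**: `scale`, the block's moves `(γ_m, v_m, χ_m)`, REPRESENTATIVES `s_i`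
(the basis polynomial is GENERATED as `q_i := Σ_m χ_m · α_m(s_i)`, normal-ordered and collected), and the factor
rows `L_i` exactly as in `GramBlock`. -/
structure GramBlockR where
  scale : ℚ
  moves : List RMove
  reps : List QPoly
  rows : List (List (ℚ × ℕ))

/-- `Σ_m χ_m · α_m(s)` before normal ordering. -/
def genPre (ms : List RMove) (s : QPoly) : QPoly := ms.flatMap fun m => pscale m.χ (movePolyF m.γ m.v s)

/-- The generated basis polynomial `q := collect (nf (Σ_m χ_m · α_m(s)))`. -/
def genOne (ms : List RMove) (s : QPoly) : QPoly := collect (nfPoly (genPre ms s))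

/-- The generated basis of a block. -/
def genBasis (B : GramBlockR) : List QPoly := B.reps.map (genOne B.moves)

/-- The ordinary Gram block the R-block STANDS FOR (PSD by `GramBlock` soundness; never expanded by the checker). -/
def toGramBlock (B : GramBlockR) : GramBlock := ⟨B.scale, genBasis B, B.rows⟩

/-- Syntactic eigen-check of one polynomial: for every move, the moved polynomial stays in the frame and
`nf(α_m q) − χ_m q` collects to zero. -/
def eigenOK (frame : List (Site 2)) (ms : List RMove) (q : QPoly) : Bool :=
  ms.all fun m => psuppIn (movePolyF m.γ m.v q) frame &&
    isZero (psub (nfPoly (movePolyF m.γ m.v q)) (pscale m.χ q))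

/-- Side conditions of an R-block: one row per representative; representatives and all their move images in the
frame; every generated basis polynomial passes the eigen-check. -/
def gramBlockROK (frame : List (Site 2)) (B : GramBlockR) : Bool :=
  B.reps.length == B.rows.length &&
    (B.reps.all fun s => psuppIn s frame && psuppIn (genPre B.moves s) frame) &&
    ((genBasis B).all fun q => eigenOK frame B.moves q)

/-- **The polynomial the checker expands**: `D_B := scale · Σ_{i,j : ⟨L_i,L_j⟩ ≠ 0} ⟨L_i, L_j⟩ · s_i† q_j`
(representatives on the left, generated basis on the right). -/
def gramBlockPolyR (B : GramBlockR) : QPoly :=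
  let sr := B.reps.zip B.rows
  let qr := (genBasis B).zip B.rows
  pscale B.scale (sr.flatMap fun a => qr.flatMap fun b =>
    let g := sdot a.2 b.2
    if g = 0 then [] else pscale g (pmul (padj a.1) b.1))

/-- A syntactic certificate with orbit-representative Gram blocks. -/
structure SymCertR extends SymCert where
  gramR : List GramBlockR

/-- The ordinary certificate `K♯` the R-certificate stands for: the generated blocks appended to `gramM`. -/
def SymCertR.expand (K : SymCertR) : SymCert :=
  { K.toSymCert with gramM := K.gramM ++ K.gramR.map toGramBlock }

/-- Right-hand side with the R-blocks in REPRESENTATIVE form: the ordinary slots, then `|moves_B| · D_B` per block. -/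
def rhsPolyR (K : SymCertR) : QPoly :=
  rhsPoly K.toSymCert ++ K.gramR.flatMap fun B => pscale (B.moves.length : ℚ) (gramBlockPolyR B)

/-- The collected normal form of `LHS − RHS_R`. -/
def residualR (K : SymCertR) : QPoly := collect (nfPoly (psub (lhsPoly K.toSymCert) (rhsPolyR K)))

/-- The identity test (same canonicaliser and corner as `identityOK`). -/
def identityOKR (K : SymCertR) : Bool :=
  let corner := flatSite (minCorner K.frame)
  isZero (if K.useCanon then (residualR K).flatMap (canonTermA corner K.frame) else residualR K)

/-- **The R-checker**: `K♯` well formed (cheap — the generated bases are small), R-block side conditions, identity. -/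
def symCheckR (K : SymCertR) : Bool :=
  wellFormed K.expand && K.gramR.all (gramBlockROK K.frame) && identityOKR K

/-- The certified value (`= symValue K♯`). -/
def symValueR (K : SymCertR) : ℚ := symValue K.toSymCert

/-- The identity test with the EXECUTED canonicaliser of `…SymReplaySyntaxV` (`canonTermAV`, integer-pair corner);
`= identityOKR K` (`identityOKRV_eq`).  This is the form data files run by `native_decide`. -/
def identityOKRV (K : SymCertR) : Bool :=
  let N := residualR K
  let cP := minCornerP K.frame
  isZero (if K.useCanon then N.flatMap (canonTermAV cP K.frame) else N)

/-- **The executed R-checker**: `wellFormed K.expand && all gramBlockROK && identityOKRV K`; `= symCheckR K`. -/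
def symCheckRV (K : SymCertR) : Bool :=
  wellFormed K.expand && K.gramR.all (gramBlockROK K.frame) && identityOKRV K

/-- `identityOKRV = identityOKR` (by `canonTermAV_eq` / `mkSite_minCornerP_eq` of `…SyntaxV`). -/
theorem identityOKRV_eq (K : SymCertR) : identityOKRV K = identityOKR K := by
  unfold identityOKRV identityOKR
  simp only [canonTermAV_eq, mkSite_minCornerP_eq]

/-- **`symCheckRV = symCheckR`.** -/
theorem symCheckRV_eq (K : SymCertR) : symCheckRV K = symCheckR K := by
  unfold symCheckRV symCheckR
  rw [identityOKRV_eq]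

/-- Transfer lemma for data files. -/
theorem symCheckR_of_symCheckRV (K : SymCertR) (h : symCheckRV K = true) : symCheckR K = true := by
  rw [← symCheckRV_eq]; exact h

/-! ### Kernel toy: `E_Φ + 11/4 + 2 (N₀ − 7/8) ≡ 8 (c_↑c_↓)†(c_↑c_↓) + Σ_σ [(1/8) Q_σ Q_σ† + (1/32) q_σ† q_σ]`
modulo licensed moves, with `Q_σ = Σ_{δ} c_{δσ}`, `q_σ = Σ_{γ ∈ D₄} α_γ(c_{0σ} − c_{e₁σ}) = 8 c_{0σ} − 2 Q_σ`;
the two `q`-squares shipped as ONE-COLUMN R-BLOCKS (representative `c_{0σ} − c_{e₁σ}`, eight moves, `χ = 1`):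
the checker expands `2 × 5` products per block instead of `5 × 5`.  Value `−11/4`. -/

/-- The eight point-group moves about the origin, trivial character. -/
def d4MovesTriv : List RMove := d4All.map fun γ => ⟨γ, ![0, 0], 1⟩

/-- The toy R-certificate (value `−11/4`). -/
def toyRCert : SymCertR where
  frame := frame3
  inner := []
  mu := -2
  c := (-11) / 4
  gram := (8, [(1, [ann 0 0, ann 0 1])]) ::
    (([0, 1] : List (Fin 2)).map fun σ =>
      ((1 : ℚ) / 8, [e1, e2, -e1, -e2].map fun y => ((1 : ℚ), [cre y σ])))
  gramM := []
  eom := []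
  moves := []
  charged := []
  wardP := []
  wardM := []
  antiH := []
  slack := []
  useCanon := true
  gramR := ([0, 1] : List (Fin 2)).map fun σ =>
    { scale := 1 / 32, moves := d4MovesTriv, reps := [[(1, [ann 0 σ]), (-1, [ann e1 σ])]], rows := [[(1, 0)]] }

/-- The toy passes the R-checker (kernel). -/
theorem toyRCert_check : symCheckR toyRCert = true := by decide +kernel

/-- The same through the executed (V) identity test. -/
theorem toyRCert_checkV : symCheckRV toyRCert = true := by decide +kernel

/-- Its value. -/
theorem toyRCert_value : symValueR toyRCert = (-11) / 4 := by decide +kernel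

/-- The lever is load-bearing: without the canonicaliser the representative form does NOT close
(`P_B − 8·D_B` is a sum of genuine identification uses). -/
example : symCheckR { toyRCert with useCanon := false } = false := by decide +kernel

end SyntaxR

/-! ### TEXT DECODER for R-certificates (extends `…SymReplayDecode`, hub-lb-sym-eng-4, additively: its readers are
reused, nothing redefined).  An R-certificate ships as TWO token strings: the ordinary certificate text (decoded by
`decodeSymCert`, grammar in `…Decode`) and the `gramR` text
`gramR: n rblockⁿ`, `rblock: p q  nM (k vx vy cp cq)ⁿᴹ  nS polyⁿˢ  nR rowⁿᴿ` — `p q` = scale, move `k` = index into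
`d4All = [r0, r1, r2, r3, sr0, sr1, sr2, sr3]` (`d4R`: `r1 (x,y) = (−y,x)`, `sr0 (x,y) = (x,−y)`), `(vx vy)` = translation,
`cp cq` = character value, `poly`/`row` as in `…Decode` (`nS` representatives, `nR = nS` factor rows). -/
section DecodeR

/-- `D₄` element by index (order of `d4All`; junk `r0` past 7). -/
def d4OfNat : ℕ → DihedralGroup 4
  | 0 => .r 0 | 1 => .r 1 | 2 => .r 2 | 3 => .r 3
  | 4 => .sr 0 | 5 => .sr 1 | 6 => .sr 2 | 7 => .sr 3
  | _ => .r 0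

/-- Read `n` moves `(k vx vy cp cq)`. -/
def rdMoves : ℕ → Toks → List RMove × Toks
  | 0, ts => ([], ts)
  | n + 1, k :: x :: y :: p :: q :: ts => let r := rdMoves n ts; (⟨d4OfNat k.toNat, mkSite x y, (p : ℚ) / (q : ℚ)⟩ :: r.1, r.2)
  | _ + 1, _ => ([], [])

/-- Read an R-block `p q nM moveⁿᴹ nS polyⁿˢ nR rowⁿᴿ`. -/
def rdRBlock (ts : Toks) : GramBlockR × Toks :=
  let s := rdQ ts
  let cm := rdNat s.2
  let m := rdMoves cm.1 cm.2
  let cb := rdNat m.2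
  let b := rdPolys cb.1 cb.2
  let cr := rdNat b.2
  let r := rdRows cr.1 cr.2
  (⟨s.1, m.1, b.1, r.1⟩, r.2)

/-- Read `n` R-blocks. -/
def rdRBlocks : ℕ → Toks → List GramBlockR × Toks
  | 0, ts => ([], ts)
  | n + 1, ts => let b := rdRBlock ts; let r := rdRBlocks n b.2; (b.1 :: r.1, r.2)

/-- Decode a `gramR` text `n rblockⁿ`. -/
def decodeGramR (ts : Toks) : List GramBlockR := let c := rdNat ts; (rdRBlocks c.1 c.2).1

/-- Tokens left over after a `gramR` text (a well-formed text leaves `0`). -/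
def decodeGramRRest (ts : Toks) : ℕ := let c := rdNat ts; (rdRBlocks c.1 c.2).2.length

/-- **Decode an R-certificate** from the ordinary certificate text and the `gramR` text. -/
def decodeSymCertR (ts tsR : Toks) : SymCertR := { toSymCert := decodeSymCert ts, gramR := decodeGramR tsR }

/-- Kernel regression: the first R-block of `toyRCert` round-trips through the text grammar
(`1 32 · 8 moves · 1 rep (2 terms) · 1 row`), compared through the checker's own zero test. -/
example :
    (let B := (rdRBlock [1, 32, 8, 0, 0, 0, 1, 1, 1, 0, 0, 1, 1, 2, 0, 0, 1, 1, 3, 0, 0, 1, 1, 4, 0, 0, 1, 1, 5, 0, 0, 1, 1,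
        6, 0, 0, 1, 1, 7, 0, 0, 1, 1, 1, 2, 1, 1, 1, 0, 0, 0, 0, -1, 1, 1, 1, 0, 0, 0, 1, 1, 1, 0]).1
     let B₀ := (toyRCert.gramR[0]?).getD ⟨0, [], [], []⟩
     decide (B.scale = B₀.scale) && decide (B.moves.length = B₀.moves.length) &&
       ((B.reps.zip B₀.reps).all fun pq => isZero (psub pq.1 pq.2)) && decide (B.rows = B₀.rows) &&
       ((B.moves.zip B₀.moves).all fun mm => decide (mm.1.γ = mm.2.γ) && decide (mm.1.χ = mm.2.χ) &&
         decide (mm.1.v 0 = mm.2.v 0) && decide (mm.1.v 1 = mm.2.v 1))) = true := by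
  decide +kernel

end DecodeR

end Summit.Ventures.CertifiedManyBodySolver.Theorems.SymReplay

/-! ## Semantics and soundness of the R-checker -/

noncomputable section

namespace Summit.Ventures.CertifiedManyBodySolver.Theorems.SymReplay

section SemanticsR

open Matrix Finset
open Literature.MathematicalPhysics.QuantumLattice
open Literature.MathematicalPhysics.QuantumLattice.HubbardWave0
open Literature.MathematicalPhysics.QuantumLattice.ThermodynamicLimit
open Literature.Probability.LatticeModels
open Literature.MathematicalPhysics.QuantumManyBody.StateRelaxation
open Summit.Ventures.CertifiedManyBodySolver.Theorems.WardSlot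
open scoped ComplexOrder BigOperators

/-! #### (a) Small list-sum helpers -/

/-- Helper: a list sum of sums splits. -/
theorem list_sum_map_flatMap {α β M : Type*} [AddCommMonoid M] (l : List α) (f : α → List β) (g : β → M) :
    ((l.flatMap f).map g).sum = (l.map fun a => ((f a).map g).sum).sum := by
  induction l with
  | nil => simp
  | cons a l ih => rw [List.flatMap_cons, List.map_append, List.sum_append, List.map_cons, List.sum_cons, ih]

/-- Helper: swapping a double list sum. -/
theorem list_sum_swap {α β M : Type*} [AddCommMonoid M] (l : List α) (ms : List β) (f : α → β → M) :
    (l.map fun a => (ms.map fun m => f a m).sum).sum = (ms.map fun m => (l.map fun a => f a m).sum).sum := by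
  induction l with
  | nil => simp
  | cons a l ih => rw [List.map_cons, List.sum_cons, ih, ← List.sum_map_add]; rfl

/-- Helper: a constant list sum is a natural multiple. -/
theorem list_sum_map_const {β M : Type*} [AddCommMonoid M] (ms : List β) (X : M) :
    (ms.map fun _ => X).sum = ms.length • X := by
  rw [List.map_const', List.sum_replicate]

/-- Helper: negation through a list sum. -/
theorem list_sum_map_neg {α M : Type*} [AddCommGroup M] (l : List α) (f : α → M) :
    (l.map fun a => -f a).sum = -(l.map f).sum := by
  induction l with
  | nil => simp
  | cons a l ih => rw [List.map_cons, List.sum_cons, List.map_cons, List.sum_cons, ih, neg_add]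

/-! #### (b) List identities of the letterwise move `movePolyF` -/

/-- `movePolyF = movePolyW` (flattening is the identity). -/
theorem movePolyF_eq (γ : DihedralGroup 4) (v : Site 2) (p : QPoly) : movePolyF γ v p = movePolyW γ v p := by
  simp only [movePolyF_def, movePolyW, moveWordF_eq]

/-- Helper `moveWordF_append'`. -/
theorem moveWordF_append' (γ : DihedralGroup 4) (v : Site 2) (u w : Word) :
    moveWordF γ v (u ++ w) = moveWordF γ v u ++ moveWordF γ v w := List.map_append

/-- Helper `moveWordF_adjWord`: the move commutes with the adjoint of a word. -/
theorem moveWordF_adjWord (γ : DihedralGroup 4) (v : Site 2) (u : Word) :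
    moveWordF γ v (adjWord u) = adjWord (moveWordF γ v u) := by
  simp only [moveWordF, adjWord, List.map_reverse, List.map_map]
  rfl

/-- Helper `movePolyF_pscale`. -/
theorem movePolyF_pscale (γ : DihedralGroup 4) (v : Site 2) (c : ℚ) (p : QPoly) :
    movePolyF γ v (pscale c p) = pscale c (movePolyF γ v p) := by
  simp only [movePolyF, pscale, List.map_map]
  rfl

/-- Helper `movePolyF_flatMap`. -/
theorem movePolyF_flatMap {α : Type*} (γ : DihedralGroup 4) (v : Site 2) (l : List α) (f : α → QPoly) :
    movePolyF γ v (l.flatMap f) = l.flatMap fun a => movePolyF γ v (f a) := by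
  simp only [movePolyF, List.map_flatMap]

/-- Helper `movePolyF_ite_nil`. -/
theorem movePolyF_ite_nil (γ : DihedralGroup 4) (v : Site 2) (c : Prop) [Decidable c] (p : QPoly) :
    movePolyF γ v (if c then [] else p) = if c then [] else movePolyF γ v p := by
  split_ifs <;> rfl

/-- Helper `movePolyF_padj`: the move commutes with the adjoint. -/
theorem movePolyF_padj (γ : DihedralGroup 4) (v : Site 2) (p : QPoly) :
    movePolyF γ v (padj p) = padj (movePolyF γ v p) := by
  simp only [movePolyF_def, padj, List.map_map, Function.comp_def, moveWordF_adjWord]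

/-- Helper `movePolyF_pmul`: the move is multiplicative on word polynomials (letterwise, exact list identity). -/
theorem movePolyF_pmul (γ : DihedralGroup 4) (v : Site 2) (p r : QPoly) :
    movePolyF γ v (pmul p r) = pmul (movePolyF γ v p) (movePolyF γ v r) := by
  simp only [movePolyF_def, pmul, List.map_flatMap, List.flatMap_map, List.map_map, Function.comp_def,
    moveWordF_append']

/-! #### (c) Operator lemmas: a moved polynomial differs from the original by identification uses -/

/-- The identification uses of moving every term of `p` by `(γ, v)`. -/
def polyUses (γ : DihedralGroup 4) (v : Site 2) (p : QPoly) : List IdUse := p.map fun t => ⟨t.1, t.2, γ, v⟩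

/-- **Pure linearity**: `polyOp (α(p)) − polyOp p = Σ_{t ∈ p} useOp ⟨t.1, t.2, γ, v⟩` (no support hypothesis —
`useOp` is literally `z • (wordOp (moveWord γ v u) − wordOp u)`). -/
theorem polyOp_movePolyF_sub (Λ' : Finset (Site 2)) (γ : DihedralGroup 4) (v : Site 2) (p : QPoly) :
    polyOp Λ' (movePolyF γ v p) - polyOp Λ' p = ((polyUses γ v p).map (useOp Λ')).sum := by
  induction p with
  | nil => simp [movePolyF, polyUses]
  | cons t p ih =>
    rw [movePolyF, List.map_cons, ← movePolyF, polyOp_cons, polyOp_cons, polyUses, List.map_cons, ← polyUses,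
      List.map_cons, List.sum_cons, ← ih, moveWordV_eq, moveWordF_eq, useOp, smul_sub]
    abel

/-- Uses of a move have the moved terms' words. -/
theorem polyUses_u {γ : DihedralGroup 4} {v : Site 2} {p : QPoly} {e : IdUse} (he : e ∈ polyUses γ v p) :
    ∃ t ∈ p, e.u = t.2 := by
  rw [polyUses, List.mem_map] at he
  obtain ⟨t, ht, rfl⟩ := he
  exact ⟨t, ht, rfl⟩

/-- **Generated basis, semantics**: `polyOp (genOne ms s) = Σ_m χ_m • polyOp (α_m s)`. -/
theorem polyOp_genOne (Λ' : Finset (Site 2)) (ms : List RMove) (s : QPoly) (hs : PSupp (genPre ms s) Λ') :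
    polyOp Λ' (genOne ms s) = (ms.map fun m => ((m.χ : ℚ) : ℂ) • polyOp Λ' (movePolyF m.γ m.v s)).sum := by
  rw [genOne, polyOp_eq_evalP, collect_eval, ← polyOp_eq_evalP, polyOp_nfPoly stub_nfFaithful _ _ hs, genPre,
    polyOp_flatMap]
  simp only [polyOp_pscale]

/-- **Eigen-check, semantics**: a passing syntactic eigen-check gives `polyOp (α_m q) = χ_m • polyOp q`. -/
theorem eigen_sound (Λ' : Finset (Site 2)) (m : RMove) (q : QPoly) (hq : PSupp (movePolyF m.γ m.v q) Λ')
    (h : isZero (psub (nfPoly (movePolyF m.γ m.v q)) (pscale m.χ q)) = true) :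
    polyOp Λ' (movePolyF m.γ m.v q) = ((m.χ : ℚ) : ℂ) • polyOp Λ' q := by
  have h0 := polyOp_eq_zero_of_isZero Λ' _ h
  rwa [polyOp_psub, polyOp_nfPoly stub_nfFaithful _ _ hq, polyOp_pscale, sub_eq_zero] at h0

/-- From `eigenOK`: per move, support and the eigen identity. -/
theorem eigenOK_spec {frame : List (Site 2)} {ms : List RMove} {q : QPoly} (h : eigenOK frame ms q = true) :
    ∀ m ∈ ms, PSupp (movePolyF m.γ m.v q) frame.toFinset ∧
      isZero (psub (nfPoly (movePolyF m.γ m.v q)) (pscale m.χ q)) = true := by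
  intro m hm
  have h' := List.all_eq_true.1 h m hm
  rw [Bool.and_eq_true] at h'
  exact ⟨PSupp_of_psuppIn h'.1, h'.2⟩

/-- Helper `padj_flatMap`. -/
theorem padj_flatMap {α : Type*} (l : List α) (f : α → QPoly) :
    padj (l.flatMap f) = l.flatMap fun a => padj (f a) := by
  simp only [padj, List.map_flatMap]

/-- Helper `padj_pscale`. -/
theorem padj_pscale (c : ℚ) (p : QPoly) : padj (pscale c p) = pscale c (padj p) := by
  simp only [padj, pscale, List.map_map]
  rfl

/-- Helper `pmul_flatMap_left`. -/
theorem pmul_flatMap_left {α : Type*} (l : List α) (f : α → QPoly) (r : QPoly) :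
    pmul (l.flatMap f) r = l.flatMap fun a => pmul (f a) r := by
  simp only [pmul, List.flatMap_assoc]

/-- Helper `pmul_pscale_left`. -/
theorem pmul_pscale_left (c : ℚ) (p r : QPoly) : pmul (pscale c p) r = pscale c (pmul p r) := by
  simp only [pmul, pscale, List.flatMap_map, List.map_flatMap, List.map_map, Function.comp_def, mul_assoc]

/-- **The pair identity**: `(q_a)† q_b = Σ_m α_m(s_a† q_b)` as operators, for `q_a` generated from `s_a` and `q_b`
passing the eigen-check for the same moves. -/
theorem polyOp_pair (Λ' : Finset (Site 2)) (ms : List RMove) (sa qb : QPoly) (hsa : PSupp (genPre ms sa) Λ')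
    (hqb : ∀ m ∈ ms, PSupp (movePolyF m.γ m.v qb) Λ' ∧
      isZero (psub (nfPoly (movePolyF m.γ m.v qb)) (pscale m.χ qb)) = true) :
    polyOp Λ' (pmul (padj (genOne ms sa)) qb) =
      (ms.map fun m => polyOp Λ' (movePolyF m.γ m.v (pmul (padj sa) qb))).sum := by
  have hG : polyOp Λ' (pmul (padj (genOne ms sa)) qb) = polyOp Λ' (pmul (padj (genPre ms sa)) qb) := by
    rw [polyOp_pmul, polyOp_pmul, polyOp_padj, polyOp_padj, polyOp_genOne Λ' ms sa hsa, genPre, polyOp_flatMap]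
    simp only [polyOp_pscale]
  rw [hG, genPre, padj_flatMap, pmul_flatMap_left, polyOp_flatMap]
  congr 1
  refine List.map_congr_left fun m hm => ?_
  obtain ⟨hq1, hq2⟩ := hqb m hm
  rw [padj_pscale, pmul_pscale_left, polyOp_pscale, polyOp_pmul, ← mul_smul_comm,
    ← eigen_sound Λ' m qb hq1 hq2, movePolyF_pmul, movePolyF_padj, polyOp_pmul]

/-! #### (d) The block identity `P_B = |moves| • D_B + Σ uses` -/

/-- The identification uses by which a block's expansion `P_B` exceeds `|moves| • D_B`. -/
def blockUses (B : GramBlockR) : List IdUse := B.moves.flatMap fun m => polyUses m.γ m.v (gramBlockPolyR B)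

/-- The expansion of an R-block, as a list: outer index over the representatives. -/
theorem gramBlockPoly_toGramBlock (B : GramBlockR) :
    gramBlockPoly (toGramBlock B) = pscale B.scale ((B.reps.zip B.rows).flatMap fun a =>
      ((genBasis B).zip B.rows).flatMap fun b =>
        if sdot a.2 b.2 = 0 then [] else pscale (sdot a.2 b.2) (pmul (padj (genOne B.moves a.1)) b.1)) := by
  unfold gramBlockPoly toGramBlock
  simp only [genBasis, List.zip_map_left, List.flatMap_map, Prod.map_fst, Prod.map_snd, id_eq]

/-- One ROW of the block: `Σ_b g_ab · q_a† q_b = Σ_m α_m(Σ_b g_ab · s_a† q_b)`. -/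
theorem polyOp_blockRow (Λ' : Finset (Site 2)) (B : GramBlockR) (a : QPoly × List (ℚ × ℕ))
    (hsa : PSupp (genPre B.moves a.1) Λ')
    (hq : ∀ q ∈ genBasis B, ∀ m ∈ B.moves, PSupp (movePolyF m.γ m.v q) Λ' ∧
      isZero (psub (nfPoly (movePolyF m.γ m.v q)) (pscale m.χ q)) = true) :
    polyOp Λ' (((genBasis B).zip B.rows).flatMap fun b =>
        if sdot a.2 b.2 = 0 then [] else pscale (sdot a.2 b.2) (pmul (padj (genOne B.moves a.1)) b.1)) =
      (B.moves.map fun m => polyOp Λ' (movePolyF m.γ m.v (((genBasis B).zip B.rows).flatMap fun b =>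
        if sdot a.2 b.2 = 0 then [] else pscale (sdot a.2 b.2) (pmul (padj a.1) b.1)))).sum := by
  simp only [movePolyF_flatMap, movePolyF_ite_nil, movePolyF_pscale]
  rw [polyOp_flatMap]
  simp only [polyOp_flatMap]
  rw [← list_sum_swap]
  congr 1
  refine List.map_congr_left fun b hb => ?_
  have hb1 : b.1 ∈ genBasis B := (List.of_mem_zip (by rw [Prod.mk.eta]; exact hb)).1
  split_ifs with hg
  · simp
  · rw [polyOp_pscale, polyOp_pair Λ' B.moves a.1 b.1 hsa (hq b.1 hb1), List.smul_sum, List.map_map]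
    congr 1
    refine List.map_congr_left fun m _ => ?_
    simp only [Function.comp, polyOp_pscale]

/-- **THE BLOCK IDENTITY.**  For an R-block whose representatives generate inside `Λ'` and whose generated basis
passes the eigen-check: `polyOp (gramBlockPoly (toGramBlock B)) = polyOp (|moves| • D_B) + Σ (blockUses B)`. -/
theorem polyOp_toGramBlock (Λ' : Finset (Site 2)) (B : GramBlockR)
    (hs : ∀ s ∈ B.reps, PSupp (genPre B.moves s) Λ')
    (hq : ∀ q ∈ genBasis B, ∀ m ∈ B.moves, PSupp (movePolyF m.γ m.v q) Λ' ∧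
      isZero (psub (nfPoly (movePolyF m.γ m.v q)) (pscale m.χ q)) = true) :
    polyOp Λ' (gramBlockPoly (toGramBlock B)) =
      polyOp Λ' (pscale (B.moves.length : ℚ) (gramBlockPolyR B)) + ((blockUses B).map (useOp Λ')).sum := by
  -- (1) `P_B = Σ_m polyOp (α_m D_B)`
  have h1 : polyOp Λ' (gramBlockPoly (toGramBlock B)) =
      (B.moves.map fun m => polyOp Λ' (movePolyF m.γ m.v (gramBlockPolyR B))).sum := by
    rw [gramBlockPoly_toGramBlock, polyOp_pscale, polyOp_flatMap]
    have hrow : ∀ a ∈ B.reps.zip B.rows,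
        polyOp Λ' (((genBasis B).zip B.rows).flatMap fun b =>
          if sdot a.2 b.2 = 0 then [] else pscale (sdot a.2 b.2) (pmul (padj (genOne B.moves a.1)) b.1)) =
        (B.moves.map fun m => polyOp Λ' (movePolyF m.γ m.v (((genBasis B).zip B.rows).flatMap fun b =>
          if sdot a.2 b.2 = 0 then [] else pscale (sdot a.2 b.2) (pmul (padj a.1) b.1)))).sum := by
      intro a ha
      have ha1 : a.1 ∈ B.reps := (List.of_mem_zip (by rw [Prod.mk.eta]; exact ha)).1
      exact polyOp_blockRow Λ' B a (hs a.1 ha1) hq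
    rw [List.map_congr_left hrow, list_sum_swap, List.smul_sum, List.map_map]
    congr 1
    refine List.map_congr_left fun m _ => ?_
    unfold gramBlockPolyR
    simp only [Function.comp, movePolyF_pscale, polyOp_pscale, movePolyF_flatMap, polyOp_flatMap]
  -- (2) `Σ_m polyOp (α_m D) = |moves| • polyOp D + Σ uses`
  rw [h1, blockUses, list_sum_map_flatMap, polyOp_pscale]
  have h2 : (B.moves.map fun m => polyOp Λ' (movePolyF m.γ m.v (gramBlockPolyR B))).sum =
      (B.moves.map fun m => polyOp Λ' (gramBlockPolyR B) + ((polyUses m.γ m.v (gramBlockPolyR B)).map (useOp Λ')).sum).sum := by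
    congr 1
    refine List.map_congr_left fun m _ => ?_
    rw [← polyOp_movePolyF_sub]; abel
  rw [h2, List.sum_map_add, list_sum_map_const, Rat.cast_natCast, Nat.cast_smul_eq_nsmul]

/-- Words of `D_B` lie where the representatives and the generated basis lie. -/
theorem PSupp_gramBlockPolyR (B : GramBlockR) {Λ : Finset (Site 2)} (hs : ∀ s ∈ B.reps, PSupp s Λ)
    (hq : ∀ q ∈ genBasis B, PSupp q Λ) : PSupp (gramBlockPolyR B) Λ := by
  unfold gramBlockPolyR
  refine PSupp.pscale _ (PSupp.flatMap _ _ fun a ha => PSupp.flatMap _ _ fun b hb => ?_)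
  have ha' : PSupp a.1 Λ := hs _ (List.of_mem_zip ha).1
  have hb' : PSupp b.1 Λ := hq _ (List.of_mem_zip hb).1
  dsimp only
  split_ifs
  · exact PSupp_nil _
  · exact (ha'.padj.pmul hb').pscale _

/-- The generated basis lies where the pre-collection generator lies. -/
theorem PSupp_genOne {ms : List RMove} {s : QPoly} {Λ : Finset (Site 2)} (h : PSupp (genPre ms s) Λ) :
    PSupp (genOne ms s) Λ := h.nfPoly.collect


/-! #### (f) Soundness of the R-checker -/

/-- Negated use (`z ↦ −z`). -/
def negUse (e : IdUse) : IdUse := ⟨-e.z, e.u, e.γ, e.v⟩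

/-- Helper `useOp_negUse`. -/
theorem useOp_negUse (Λ' : Finset (Site 2)) (e : IdUse) : useOp Λ' (negUse e) = -useOp Λ' e := by
  simp only [useOp, negUse, Rat.cast_neg, neg_smul]

/-- The canonicaliser's uses on the R-residual. -/
def canonUsesR (K : SymCertR) : List IdUse :=
  if K.useCanon then (residualR K).flatMap (usesOfTerm (flatSite (minCorner K.frame)) K.frame) else []

/-- The identification family DERIVED (never shipped) for an R-certificate: the canonicaliser's uses, then the
negated block uses of every R-block. -/
def usesR (K : SymCertR) : List IdUse := canonUsesR K ++ (K.gramR.flatMap blockUses).map negUse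

/-- The residual equation for a general polynomial `P` passing the (canonicalised) zero test:
`polyOp Λ' P = Σ (canonicaliser's uses)` (T9's `residual_expansion` with `psub lhs rhs` generalised to `P`). -/
theorem residual_expansion_poly (h1 : NfFaithful) {Λ' : Finset (Site 2)} (corner : Site 2) (frame : List (Site 2))
    (useCanon : Bool) (P : QPoly) (hfr : frame.toFinset ⊆ Λ') (hsupp : PSupp P Λ')
    (hid : isZero (if useCanon then (collect (nfPoly P)).flatMap (canonTermA corner frame)
      else collect (nfPoly P)) = true) :
    polyOp Λ' P = ((if useCanon then (collect (nfPoly P)).flatMap (usesOfTerm corner frame) else []).map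
      (useOp Λ')).sum := by
  have hres : polyOp Λ' (collect (nfPoly P)) = polyOp Λ' P := by
    rw [polyOp_eq_evalP, collect_eval, ← polyOp_eq_evalP, polyOp_nfPoly h1 _ _ hsupp]
  rw [← hres]
  cases useCanon
  · simp only [Bool.false_eq_true, if_false] at hid ⊢
    rw [List.map_nil, List.sum_nil]
    exact polyOp_eq_zero_of_isZero Λ' _ hid
  · simp only [if_true] at hid ⊢
    rw [← sum_canonTerm h1 _ _ hfr (collect (nfPoly P)), polyOp_eq_zero_of_isZero Λ' _ hid, sub_zero]

/-- `rhsPoly` of the expansion = `rhsPolyR` + the block uses (operator level, in any `Λ'` where the R-blocks'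
representatives generate and their generated bases pass the eigen-check). -/
theorem polyOp_rhsPoly_expand (Λ' : Finset (Site 2)) (K : SymCertR)
    (hB : ∀ B ∈ K.gramR, (∀ s ∈ B.reps, PSupp (genPre B.moves s) Λ') ∧
      ∀ q ∈ genBasis B, ∀ m ∈ B.moves, PSupp (movePolyF m.γ m.v q) Λ' ∧
        isZero (psub (nfPoly (movePolyF m.γ m.v q)) (pscale m.χ q)) = true) :
    polyOp Λ' (rhsPoly K.expand) =
      polyOp Λ' (rhsPolyR K) + ((K.gramR.flatMap blockUses).map (useOp Λ')).sum := by
  have hX : polyOp Λ' ((K.gramR.map toGramBlock).flatMap gramBlockPoly) =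
      polyOp Λ' (K.gramR.flatMap fun B => pscale (B.moves.length : ℚ) (gramBlockPolyR B)) +
        ((K.gramR.flatMap blockUses).map (useOp Λ')).sum := by
    rw [List.flatMap_map, polyOp_flatMap, polyOp_flatMap, list_sum_map_flatMap, ← List.sum_map_add]
    congr 1
    exact List.map_congr_left fun B hBm => polyOp_toGramBlock Λ' B (hB B hBm).1 (hB B hBm).2
  simp only [rhsPoly, rhsPolyR, SymCertR.expand, List.flatMap_append, polyOp_append, hX]
  abel

/-- Every term of `rhsPoly K.toSymCert` is a term of `rhsPoly K.expand`. -/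
theorem rhsPoly_subset_expand (K : SymCertR) : ∀ t ∈ rhsPoly K.toSymCert, t ∈ rhsPoly K.expand := by
  intro t ht
  simp only [rhsPoly, SymCertR.expand, List.mem_append, List.flatMap_append] at ht ⊢
  tauto

/-- From `gramBlockROK`: lengths, supports of representatives / generators, and the eigen-checks. -/
theorem gramBlockROK_spec {frame : List (Site 2)} {B : GramBlockR} (h : gramBlockROK frame B = true) :
    (∀ s ∈ B.reps, PSupp s frame.toFinset ∧ PSupp (genPre B.moves s) frame.toFinset) ∧
    ∀ q ∈ genBasis B, ∀ m ∈ B.moves, PSupp (movePolyF m.γ m.v q) frame.toFinset ∧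
      isZero (psub (nfPoly (movePolyF m.γ m.v q)) (pscale m.χ q)) = true := by
  simp only [gramBlockROK, Bool.and_eq_true, List.all_eq_true] at h
  obtain ⟨⟨-, hs⟩, hq⟩ := h
  exact ⟨fun s hs' => ⟨PSupp_of_psuppIn (hs s hs').1, PSupp_of_psuppIn (hs s hs').2⟩,
    fun q hq' => eigenOK_spec (hq q hq')⟩

/-- **THE R-CHECKER IS SOUND**: every `SymCertR` passing `symCheckR` is a Ward × affine-`D₄` window certificate of
value `symValueR K`.  Witness = T10's witness for the EXPANSION `K.expand` (whose Gram multiplier contains the full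
orbit-generated blocks, PSD by `gramMat_posSemidef`), identification family `usesR K` (derived, not shipped). -/
theorem symCheckR_sound (K : SymCertR) (hK : symCheckR K = true) : WardD4CertGe ((symValueR K : ℚ) : ℝ) := by
  -- (0) unpack
  have hK' := hK
  simp only [symCheckR, Bool.and_eq_true] at hK'
  obtain ⟨⟨hwf, hRok⟩, hid⟩ := hK'
  have hRok' : ∀ B ∈ K.gramR, gramBlockROK K.frame B = true := List.all_eq_true.1 hRok
  -- (1) well-formedness clauses of the expansion needed for supports
  have hwf' := hwf
  simp only [wellFormed, Bool.and_eq_true] at hwf'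
  obtain ⟨⟨⟨⟨⟨⟨⟨⟨⟨⟨⟨⟨⟨hnd, hz0⟩, hn0⟩, hIF⟩, hth⟩, hgram⟩, hgM⟩, heom⟩, hmov⟩, hch⟩, hwp⟩, hwm⟩, hah⟩, hsl⟩ :=
    hwf'
  have hmov' : ∀ mv ∈ K.expand.moves, suppIn mv.u K.expand.frame = true ∧
      suppIn (moveWordF mv.γ mv.v mv.u) K.expand.frame = true := fun mv hmv => by
    have h := List.all_eq_true.1 hmov mv hmv
    rwa [Bool.and_eq_true] at h
  have h0F : thicken ({0} : Finset (Site 2)) 1 ⊆ K.expand.frame.toFinset := by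
    have h : subSites (thick [0]) K.expand.frame = true := by simpa [thick] using hn0
    have h' := thicken_subset_of_thick h
    simpa using h'
  have hsRx : PSupp (rhsPoly K.expand) K.frame.toFinset :=
    PSupp_rhsPoly K.expand
      (fun g hg => by
        have h := List.all_eq_true.1 hgram g hg
        rw [Bool.and_eq_true, decide_eq_true_eq] at h
        exact h.2)
      (fun B hB => by
        have h := List.all_eq_true.1 hgM B hB
        simp only [gramBlockOK, Bool.and_eq_true, decide_eq_true_eq, List.all_eq_true] at h
        exact h.2)
      (fun B hB => List.all_eq_true.1 heom B hB) hIF hmov'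
      (fun t ht => by
        have h := List.all_eq_true.1 hch t ht
        rw [Bool.and_eq_true] at h
        exact h.1)
      (fun X hX => List.all_eq_true.1 hwp X hX) (fun X hX => List.all_eq_true.1 hwm X hX)
      (fun t ht => List.all_eq_true.1 hah t ht) (fun t ht => List.all_eq_true.1 hsl t ht)
  have hsRb : PSupp (rhsPoly K.toSymCert) K.frame.toFinset := fun t ht => hsRx t (rhsPoly_subset_expand K t ht)
  have hsD : ∀ B ∈ K.gramR, PSupp (gramBlockPolyR B) K.frame.toFinset := fun B hB =>
    PSupp_gramBlockPolyR B (fun s hs => ((gramBlockROK_spec (hRok' B hB)).1 s hs).1)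
      (fun q hq => by
        rw [genBasis, List.mem_map] at hq
        obtain ⟨s, hs, rfl⟩ := hq
        exact PSupp_genOne ((gramBlockROK_spec (hRok' B hB)).1 s hs).2)
  have hsRR : PSupp (rhsPolyR K) K.frame.toFinset :=
    hsRb.append (PSupp.flatMap _ _ fun B hB => (hsD B hB).pscale _)
  have hsL : PSupp (lhsPoly K.toSymCert) K.frame.toFinset := PSupp_lhsPoly K.toSymCert h0F
  have hP : PSupp (psub (lhsPoly K.toSymCert) (rhsPolyR K)) K.frame.toFinset := hsL.psub hsRR
  -- (2) the derived identification family lies on frame words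
  have hU : ∀ e ∈ usesR K, SuppIn e.u K.expand.frame.toFinset := by
    intro e he
    rw [usesR, List.mem_append] at he
    rcases he with he | he
    · rw [canonUsesR] at he
      split_ifs at he with hc
      · rw [List.mem_flatMap] at he
        obtain ⟨t, ht, he⟩ := he
        rw [(usesOfTerm_spec e he).1]
        exact hP.nfPoly.collect t ht
      · simp at he
    · rw [List.mem_map] at he
      obtain ⟨e', he', rfl⟩ := he
      rw [List.mem_flatMap] at he'
      obtain ⟨B, hB, he'⟩ := he'
      rw [blockUses, List.mem_flatMap] at he'
      obtain ⟨m, -, he'⟩ := he'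
      obtain ⟨t, ht, hu⟩ := polyUses_u he'
      show SuppIn e'.u K.frame.toFinset
      rw [hu]
      exact hsD B hB t ht
  -- (3) the residual equation in the enlarged frame `Λ″`
  have hL : (envelope K.expand (usesR K)).toList.toFinset = envelope K.expand (usesR K) := Finset.toList_toFinset _
  have hFL : K.frame.toFinset ⊆ (envelope K.expand (usesR K)).toList.toFinset := by
    rw [hL]; exact (subset_thicken _ 1).trans (thicken_subset_envelope K.expand (usesR K))
  have hBL : ∀ B ∈ K.gramR, (∀ s ∈ B.reps, PSupp (genPre B.moves s) (envelope K.expand (usesR K)).toList.toFinset) ∧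
      ∀ q ∈ genBasis B, ∀ m ∈ B.moves,
        PSupp (movePolyF m.γ m.v q) (envelope K.expand (usesR K)).toList.toFinset ∧
          isZero (psub (nfPoly (movePolyF m.γ m.v q)) (pscale m.χ q)) = true := fun B hB =>
    ⟨fun s hs => (((gramBlockROK_spec (hRok' B hB)).1 s hs).2).mono hFL,
      fun q hq m hm => ⟨((gramBlockROK_spec (hRok' B hB)).2 q hq m hm).1.mono hFL,
        ((gramBlockROK_spec (hRok' B hB)).2 q hq m hm).2⟩⟩
  have hid' : isZero (if K.useCanon then (collect (nfPoly (psub (lhsPoly K.toSymCert) (rhsPolyR K)))).flatMap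
      (canonTermA (flatSite (minCorner K.frame)) K.frame)
      else collect (nfPoly (psub (lhsPoly K.toSymCert) (rhsPolyR K)))) = true := hid
  have h1 := residual_expansion_poly stub_nfFaithful (flatSite (minCorner K.frame)) K.frame K.useCanon
    (psub (lhsPoly K.toSymCert) (rhsPolyR K)) hFL (hP.mono hFL) hid'
  rw [polyOp_psub] at h1
  have h2 := polyOp_rhsPoly_expand (envelope K.expand (usesR K)).toList.toFinset K hBL
  have hR : polyOp (envelope K.expand (usesR K)).toList.toFinset (lhsPoly K.expand) -
      polyOp (envelope K.expand (usesR K)).toList.toFinset (rhsPoly K.expand) =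
      ((usesR K).map (useOp (envelope K.expand (usesR K)).toList.toFinset)).sum := by
    have hl : lhsPoly K.expand = lhsPoly K.toSymCert := rfl
    have hsum : ∀ Λ' : Finset (Site 2), ((usesR K).map (useOp Λ')).sum =
        ((canonUsesR K).map (useOp Λ')).sum - ((K.gramR.flatMap blockUses).map (useOp Λ')).sum := fun Λ' => by
      rw [usesR, List.map_append, List.sum_append, List.map_map, sub_eq_add_neg, ← list_sum_map_neg]
      simp only [Function.comp_def, useOp_negUse]
    have h1' : polyOp (envelope K.expand (usesR K)).toList.toFinset (lhsPoly K.toSymCert) -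
        polyOp (envelope K.expand (usesR K)).toList.toFinset (rhsPolyR K) =
        ((canonUsesR K).map (useOp (envelope K.expand (usesR K)).toList.toFinset)).sum := by
      rw [canonUsesR, residualR]; exact h1
    rw [hl, h2, hsum, ← h1']
    abel
  -- (4) S4 in expansion form (T12a `wardD4CertGe_of_expansion`, hub-lb-sym-eng-3) with the family `usesR K`
  exact wardD4CertGe_of_expansion K.expand hwf (usesR K) hU (eq_add_of_sub_eq' hR)

/-- **UNCONDITIONAL: every R-certificate passing `symCheckR` bounds `e₀(t=1, t'=0, U=8, n=7/8)` from below by its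
value** (S6 = `WardSlot.stub_wardWindowSound`).  Axioms `propext / Classical.choice / Quot.sound`. -/
theorem energyDensity_ge_symValueR (K : SymCertR) (hK : symCheckR K = true) :
    ((symValueR K : ℚ) : ℝ) ≤ energyDensityTT' 1 0 8 (7 / 8) :=
  energyDensity_ge_of_windowSound_cert _ WardSlot.stub_wardWindowSound (symCheckR_sound K hK)

/-- **The first ORBIT-REPRESENTATIVE certificate replayed end to end, NO hypothesis**: `toyRCert` (two R-blocks
`s_σ = c_{0σ} − c_{e₁σ}` under the trivial irrep of `D₄` about `0`, kernel-checked by `decide +kernel`) gives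
`−11/4 ≤ e₀(8, 7/8, 0)` (value-wise trivial; the point is that the R-path is kernel-closed on a toy). -/
theorem toyRCert_energy_ge : (((-11) / 4 : ℚ) : ℝ) ≤ energyDensityTT' 1 0 8 (7 / 8) := by
  have h := energyDensity_ge_symValueR toyRCert toyRCert_check
  rwa [toyRCert_value] at h

end SemanticsR

/-! ### (g) SHARDED R-certificates — T12b's contract (`…ShardsB`, hub-lb-sym-eng-3) with `rhsPoly ↦ rhsPolyR`

The shards of an R-certificate are T12b's shards of the UNDERLYING certificate `K.toSymCert` (base shard + row chunks of
every ordinary `gramM` block — the generated blocks are never expanded) followed by the row chunks of every R-block's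
REPRESENTATIVE expansion `reps† × genBasis` (chunks of `c + 1` representatives, each carrying `−(|moves|·scale) •`).
They sum to `LHS − RHS_R`; T12b's per-shard pipe `canonNF`, its two-list facts `Facts₂` and their assembly `facts₂_sum`
are reused verbatim; the block lemma of §(d) supplies `RHS(K♯) = RHS_R + Σ block uses`; T12a closes. -/
section ShardsR

open Matrix Finset
open Literature.MathematicalPhysics.QuantumLattice
open Literature.MathematicalPhysics.QuantumLattice.HubbardWave0
open Literature.MathematicalPhysics.QuantumLattice.ThermodynamicLimit
open Literature.Probability.LatticeModels
open Literature.MathematicalPhysics.QuantumManyBody.StateRelaxation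
open Summit.Ventures.CertifiedManyBodySolver.Theorems.WardSlot
open scoped ComplexOrder BigOperators

/-- Row chunk of an R-block's representative expansion: rows `a ∈ ch ⊆ reps.zip rows` against the generated basis. -/
def blockRowsPolyR (B : GramBlockR) (ch : List (QPoly × List (ℚ × ℕ))) : QPoly :=
  ch.flatMap fun a => ((genBasis B).zip B.rows).flatMap fun b =>
    let g := sdot a.2 b.2
    if g = 0 then [] else pscale g (pmul (padj a.1) b.1)

/-- The shards of one R-block: `−(|moves|·scale) • (rows of a chunk)` per chunk of `c + 1` representatives. -/
def blockShardPolysR (c : ℕ) (B : GramBlockR) : List QPoly :=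
  (chunksOf c (B.reps.zip B.rows).length (B.reps.zip B.rows)).map fun ch =>
    pscale (-((B.moves.length : ℚ) * B.scale)) (blockRowsPolyR B ch)

/-- The representative-form block is `scale •` the rows of the full representative list. -/
theorem gramBlockPolyR_eq (B : GramBlockR) :
    gramBlockPolyR B = pscale B.scale (blockRowsPolyR B (B.reps.zip B.rows)) := rfl

/-- `blockRowsPolyR` is additive in the chunk. -/
theorem polyOp_blockRowsPolyR_flatten (Λ' : Finset (Site 2)) (B : GramBlockR) :
    ∀ (chs : List (List (QPoly × List (ℚ × ℕ)))),
      polyOp Λ' (blockRowsPolyR B chs.flatten) = (chs.map fun ch => polyOp Λ' (blockRowsPolyR B ch)).sum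
  | [] => by simp [blockRowsPolyR]
  | ch :: chs => by
    rw [List.flatten_cons, List.map_cons, List.sum_cons, ← polyOp_blockRowsPolyR_flatten Λ' B chs, ← polyOp_append]
    rw [blockRowsPolyR, blockRowsPolyR, blockRowsPolyR, List.flatMap_append]

/-- The shards of an R-block sum to MINUS its `rhsPolyR` slot `|moves| • D_B`. -/
theorem sum_blockShardPolysR (Λ' : Finset (Site 2)) (c : ℕ) (B : GramBlockR) :
    ((blockShardPolysR c B).map (polyOp Λ')).sum = -polyOp Λ' (pscale (B.moves.length : ℚ) (gramBlockPolyR B)) := by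
  have h := polyOp_blockRowsPolyR_flatten Λ' B (chunksOf c (B.reps.zip B.rows).length (B.reps.zip B.rows))
  rw [flatten_chunksOf] at h
  rw [gramBlockPolyR_eq, polyOp_pscale, polyOp_pscale, smul_smul, ← Rat.cast_mul, h, blockShardPolysR]
  have e : (List.map (fun ch => pscale (-((B.moves.length : ℚ) * B.scale)) (blockRowsPolyR B ch))
      (chunksOf c (B.reps.zip B.rows).length (B.reps.zip B.rows))) =
      ((chunksOf c (B.reps.zip B.rows).length (B.reps.zip B.rows)).map (blockRowsPolyR B)).map
        (fun p => pscale (-((B.moves.length : ℚ) * B.scale)) p) := by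
    rw [List.map_map]; rfl
  rw [e, sum_map_pscale_neg, List.map_map]
  rfl

/-- **All shards of an R-certificate**: T12b's shards of the underlying certificate, then every R-block's chunk shards. -/
def shardPolysR (K : SymCertR) (c : ℕ) : List QPoly :=
  shardPolys K.toSymCert c ++ K.gramR.flatMap (blockShardPolysR c)

/-- The shards of a list of R-blocks sum to minus their `rhsPolyR` slots. -/
theorem sum_flatMap_blockShardPolysR (Λ' : Finset (Site 2)) (c : ℕ) :
    ∀ (Bs : List GramBlockR), ((Bs.flatMap (blockShardPolysR c)).map (polyOp Λ')).sum =
      -polyOp Λ' (Bs.flatMap fun B => pscale (B.moves.length : ℚ) (gramBlockPolyR B))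
  | [] => by simp
  | B :: Bs => by
    rw [List.flatMap_cons, List.map_append, List.sum_append, sum_blockShardPolysR, sum_flatMap_blockShardPolysR Λ' c Bs,
      List.flatMap_cons, polyOp_append, neg_add]

/-- **The R-shards sum to `LHS − RHS_R`.** -/
theorem sum_shardPolysR (Λ' : Finset (Site 2)) (K : SymCertR) (c : ℕ) :
    ((shardPolysR K c).map (polyOp Λ')).sum = polyOp Λ' (lhsPoly K.toSymCert) - polyOp Λ' (rhsPolyR K) := by
  rw [shardPolysR, List.map_append, List.sum_append, sum_shardPolys, sum_flatMap_blockShardPolysR, rhsPolyR,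
    polyOp_append]
  abel

/-- The `j`-th R-shard (`[]` past the end). -/
def shardPolyAtR (K : SymCertR) (c j : ℕ) : QPoly := ((shardPolysR K c)[j]?).getD []

/-- **What ONE farm call proves about R-shard `j`** against its shipped partial `P` (T12b's `shardOK`, R-shards). -/
def shardOKR (K : SymCertR) (c j : ℕ) (P : QPoly) : Bool :=
  psuppIn P K.frame && isZero (psub (canonNF K.frame (shardPolyAtR K c j)) P)

/-- The per-call facts for R-shards `j, j+1, …` against the partials `Ps` (structural on the literal `Ps`). -/
def ShardFactsR (K : SymCertR) (c : ℕ) : ℕ → List QPoly → Prop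
  | _, [] => True
  | j, P :: Ps => shardOKR K c j P = true ∧ ShardFactsR K c (j + 1) Ps

/-- Index-based R-shard facts give T12b's two-list facts on the corresponding suffix of `shardPolysR`. -/
theorem facts₂_of_shardFactsR (K : SymCertR) (c : ℕ) :
    ∀ (Ps : List QPoly) (j : ℕ), ((shardPolysR K c).drop j).length = Ps.length →
      ShardFactsR K c j Ps → Facts₂ K.toSymCert ((shardPolysR K c).drop j) Ps
  | [], j, hl, _ => by
    rw [List.length_nil, List.length_eq_zero_iff] at hl
    rw [hl]; trivial
  | P :: Ps, j, hl, hf => by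
    have hj : j < (shardPolysR K c).length := by
      rw [List.length_drop, List.length_cons] at hl; omega
    rw [List.drop_eq_getElem_cons hj]
    have hQ : shardPolyAtR K c j = (shardPolysR K c)[j] := by
      rw [shardPolyAtR, List.getElem?_eq_getElem hj]; rfl
    refine ⟨?_, facts₂_of_shardFactsR K c Ps (j + 1) ?_ hf.2⟩
    · rw [← hQ]; exact hf.1
    · have := hl; rw [List.drop_eq_getElem_cons hj, List.length_cons, List.length_cons] at this; omega

/-- Words of a row chunk of an R-block lie where the representatives and the generated basis do. -/
theorem PSupp_blockRowsPolyR (B : GramBlockR) {Λ : Finset (Site 2)} (hs : ∀ s ∈ B.reps, PSupp s Λ)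
    (hq : ∀ q ∈ genBasis B, PSupp q Λ) (ch : List (QPoly × List (ℚ × ℕ))) (hch : ∀ a ∈ ch, a ∈ B.reps.zip B.rows) :
    PSupp (blockRowsPolyR B ch) Λ := by
  refine PSupp.flatMap _ _ fun a ha => PSupp.flatMap _ _ fun b hb => ?_
  have ha' : PSupp a.1 Λ := hs _ (List.of_mem_zip (hch a ha)).1
  have hb' : PSupp b.1 Λ := hq _ (List.of_mem_zip hb).1
  dsimp only
  split_ifs
  · exact PSupp_nil _
  · exact (ha'.padj.pmul hb').pscale _

/-- Words of every R-block shard lie where the representatives and the generated basis do. -/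
theorem PSupp_blockShardPolysR (c : ℕ) (B : GramBlockR) {Λ : Finset (Site 2)} (hs : ∀ s ∈ B.reps, PSupp s Λ)
    (hq : ∀ q ∈ genBasis B, PSupp q Λ) : ∀ Q ∈ blockShardPolysR c B, PSupp Q Λ := by
  intro Q hQ
  rw [blockShardPolysR, List.mem_map] at hQ
  obtain ⟨ch, hch, rfl⟩ := hQ
  refine (PSupp_blockRowsPolyR B hs hq ch fun a ha => ?_).pscale _
  rw [← flatten_chunksOf c (B.reps.zip B.rows).length (B.reps.zip B.rows), List.mem_flatten]
  exact ⟨ch, hch, ha⟩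

/-- **SHARDED R-REPLAY IS SOUND.**  For an R-certificate whose expansion `K♯` is well formed and whose R-blocks pass
`gramBlockROK` (generation + eigen-checks — no products), a chunk size `c`, shipped partials `Ps` (one per shard of
`shardPolysR K c`), the per-call facts `ShardFactsR K c 0 Ps`, and the final fact
`isZero (canonNF K.frame (P_0 ++ … ++ P_m)) = true`: `K` is a Ward × affine-`D₄` window certificate of value `symValueR K`. -/
theorem wardD4CertGe_of_shardsR (K : SymCertR) (hwf0 : wellFormed K.expand = true)
    (hRok : K.gramR.all (gramBlockROK K.frame) = true) (c : ℕ) (Ps : List QPoly)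
    (hlen : (shardPolysR K c).length = Ps.length) (hfacts : ShardFactsR K c 0 Ps)
    (hfin : isZero (canonNF K.frame Ps.flatten) = true) : WardD4CertGe ((symValueR K : ℚ) : ℝ) := by
  have hRok' : ∀ B ∈ K.gramR, gramBlockROK K.frame B = true := List.all_eq_true.1 hRok
  /- (1) the well-formedness clauses of `K♯` needed for the supports -/
  have hwf := hwf0
  simp only [wellFormed, Bool.and_eq_true] at hwf
  obtain ⟨⟨⟨⟨⟨⟨⟨⟨⟨⟨⟨⟨⟨-, hz0⟩, hn0⟩, hIF⟩, -⟩, hgram⟩, hgM⟩, heom⟩, hmov⟩, hch⟩, hwp⟩, hwm⟩, hah⟩, hsl⟩ := hwf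
  have hgram' : ∀ g ∈ K.toSymCert.gram, psuppIn g.2 K.toSymCert.frame = true := fun g hg => by
    have h := List.all_eq_true.1 hgram g hg
    rw [Bool.and_eq_true] at h
    exact h.2
  have hgM' : ∀ B ∈ K.toSymCert.gramM, ∀ q ∈ B.basis, PSupp q K.frame.toFinset := fun B hB q hq => by
    have hB' : B ∈ K.expand.gramM := by
      change B ∈ K.gramM ++ K.gramR.map toGramBlock
      exact List.mem_append_left _ hB
    have h := List.all_eq_true.1 hgM B hB'
    simp only [gramBlockOK, Bool.and_eq_true, List.all_eq_true] at h
    exact PSupp_of_psuppIn (h.2 q hq)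
  have heom' : ∀ B ∈ K.toSymCert.eom, psuppIn B K.toSymCert.inner = true := fun B hB => List.all_eq_true.1 heom B hB
  have hmov' : ∀ mv ∈ K.toSymCert.moves, suppIn mv.u K.toSymCert.frame = true ∧
      suppIn (moveWordF mv.γ mv.v mv.u) K.toSymCert.frame = true := fun mv hmv => by
    have h := List.all_eq_true.1 hmov mv hmv
    rwa [Bool.and_eq_true] at h
  have hch' : ∀ t ∈ K.toSymCert.charged, suppIn t.2 K.toSymCert.frame = true := fun t ht => by
    have h := List.all_eq_true.1 hch t ht
    rw [Bool.and_eq_true] at h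
    exact h.1
  have hwp' : ∀ X ∈ K.toSymCert.wardP, psuppIn X K.toSymCert.frame = true := fun X hX => List.all_eq_true.1 hwp X hX
  have hwm' : ∀ X ∈ K.toSymCert.wardM, psuppIn X K.toSymCert.frame = true := fun X hX => List.all_eq_true.1 hwm X hX
  have hah' : ∀ t ∈ K.toSymCert.antiH, psuppIn t.2 K.toSymCert.frame = true := fun t ht => List.all_eq_true.1 hah t ht
  have hsl' : ∀ t ∈ K.toSymCert.slack, suppIn t.2 K.toSymCert.frame = true := fun t ht => List.all_eq_true.1 hsl t ht
  have h0F : thicken ({0} : Finset (Site 2)) 1 ⊆ K.expand.frame.toFinset := by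
    have h : subSites (thick [0]) K.expand.frame = true := by simpa [thick] using hn0
    have h' := thicken_subset_of_thick h
    simpa using h'
  have hsD : ∀ B ∈ K.gramR, (∀ s ∈ B.reps, PSupp s K.frame.toFinset) ∧ ∀ q ∈ genBasis B, PSupp q K.frame.toFinset :=
    fun B hB => ⟨fun s hs => ((gramBlockROK_spec (hRok' B hB)).1 s hs).1, fun q hq => by
      rw [genBasis, List.mem_map] at hq
      obtain ⟨s, hs, rfl⟩ := hq
      exact PSupp_genOne ((gramBlockROK_spec (hRok' B hB)).1 s hs).2⟩
  /- (2) supports of all R-shards -/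
  have hQ : ∀ Q ∈ shardPolysR K c, PSupp Q K.frame.toFinset := by
    intro Q hQ
    rw [shardPolysR, List.mem_append, shardPolys, List.mem_cons] at hQ
    rcases hQ with (rfl | hQ) | hQ
    · exact (PSupp_lhsPoly K.toSymCert h0F).psub
        (PSupp_rhsNonBlock K.toSymCert hgram' heom' hIF hmov' hch' hwp' hwm' hah' hsl')
    · rw [List.mem_flatMap] at hQ
      obtain ⟨B, hB, hQ⟩ := hQ
      exact PSupp_blockShardPolys c B (hgM' B hB) Q hQ
    · rw [List.mem_flatMap] at hQ
      obtain ⟨B, hB, hQ⟩ := hQ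
      exact PSupp_blockShardPolysR c B (hsD B hB).1 (hsD B hB).2 Q hQ
  /- (3) the two-list facts -/
  have hF : Facts₂ K.toSymCert (shardPolysR K c) Ps := by
    have h := facts₂_of_shardFactsR K c Ps 0 (by rw [List.drop_zero]; exact hlen) hfacts
    rwa [List.drop_zero] at h
  /- (4) the DERIVED use family and its envelope -/
  let U := ((shardPolysR K c).flatMap (canonNFUses K.frame) ++ canonNFUses K.frame Ps.flatten) ++
    (K.gramR.flatMap blockUses).map negUse
  have hL : (envelope K.expand U).toList.toFinset = envelope K.expand U := Finset.toList_toFinset _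
  have hFL : K.frame.toFinset ⊆ (envelope K.expand U).toList.toFinset := by
    rw [hL]; exact (subset_thicken _ 1).trans (thicken_subset_envelope K.expand U)
  obtain ⟨hsum, hPs⟩ := facts₂_sum K.toSymCert hFL (shardPolysR K c) Ps hF hQ
  have hU : ∀ e ∈ U, SuppIn e.u K.expand.frame.toFinset := by
    intro e he
    rcases List.mem_append.1 he with he | he
    · rcases List.mem_append.1 he with he | he
      · rw [List.mem_flatMap] at he
        obtain ⟨Q, hQ', he⟩ := he
        exact canonNFUses_supp K.frame Q (hQ Q hQ') e he
      · exact canonNFUses_supp K.frame _ hPs e he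
    · rw [List.mem_map] at he
      obtain ⟨e', he', rfl⟩ := he
      rw [List.mem_flatMap] at he'
      obtain ⟨B, hB, he'⟩ := he'
      rw [blockUses, List.mem_flatMap] at he'
      obtain ⟨m, -, he'⟩ := he'
      obtain ⟨t, ht, hu⟩ := polyUses_u he'
      show SuppIn e'.u K.frame.toFinset
      rw [hu]
      exact PSupp_gramBlockPolyR B (hsD B hB).1 (hsD B hB).2 t ht
  refine wardD4CertGe_of_expansion K.expand hwf0 U hU ?_
  /- (5) the expansion: LHS − RHS(K♯) = (LHS − RHS_R) − Σ block uses = Σ partials + shard uses − block uses,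
        and Σ partials = final uses -/
  have hBL : ∀ B ∈ K.gramR, (∀ s ∈ B.reps, PSupp (genPre B.moves s) (envelope K.expand U).toList.toFinset) ∧
      ∀ q ∈ genBasis B, ∀ m ∈ B.moves,
        PSupp (movePolyF m.γ m.v q) (envelope K.expand U).toList.toFinset ∧
          isZero (psub (nfPoly (movePolyF m.γ m.v q)) (pscale m.χ q)) = true := fun B hB =>
    ⟨fun s hs => (((gramBlockROK_spec (hRok' B hB)).1 s hs).2).mono hFL,
      fun q hq m hm => ⟨((gramBlockROK_spec (hRok' B hB)).2 q hq m hm).1.mono hFL,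
        ((gramBlockROK_spec (hRok' B hB)).2 q hq m hm).2⟩⟩
  have h2 := polyOp_rhsPoly_expand (envelope K.expand U).toList.toFinset K hBL
  have hfinal := canonNF_expansion K.frame hFL Ps.flatten (hPs.mono hFL)
  rw [polyOp_eq_zero_of_isZero _ _ hfin, zero_add] at hfinal
  rw [sum_shardPolysR] at hsum
  have hl : lhsPoly K.expand = lhsPoly K.toSymCert := rfl
  have hneg : (((K.gramR.flatMap blockUses).map negUse).map (useOp (envelope K.expand U).toList.toFinset)).sum =
      -((K.gramR.flatMap blockUses).map (useOp (envelope K.expand U).toList.toFinset)).sum := by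
    rw [List.map_map, ← list_sum_map_neg]
    simp only [Function.comp_def, useOp_negUse]
  rw [hl, h2, List.map_append, List.sum_append, List.map_append, List.sum_append, ← hfinal, hneg,
    sub_eq_iff_eq_add.1 hsum]
  abel

/-- **Corollary**: a sharded R-certificate bounds the energy density (S6 = `WardSlot.stub_wardWindowSound`). -/
theorem energyDensity_ge_of_shardsR (K : SymCertR) (hwf : wellFormed K.expand = true)
    (hRok : K.gramR.all (gramBlockROK K.frame) = true) (c : ℕ) (Ps : List QPoly)
    (hlen : (shardPolysR K c).length = Ps.length) (hfacts : ShardFactsR K c 0 Ps)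
    (hfin : isZero (canonNF K.frame Ps.flatten) = true) :
    ((symValueR K : ℚ) : ℝ) ≤ energyDensityTT' 1 0 8 (7 / 8) :=
  energyDensity_ge_of_windowSound_cert _ WardSlot.stub_wardWindowSound
    (wardD4CertGe_of_shardsR K hwf hRok c Ps hlen hfacts hfin)

/-! ##### The EXECUTED per-shard pipe (canonicaliser `canonTermAV` of `…SyntaxV`, integer-pair corner) -/

/-- T12b's per-shard pipe with the executed canonicaliser `canonTermAV` (same value, `canonNFAV_eq`). -/
def canonNFAV (frame : List (Site 2)) (p : QPoly) : QPoly :=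
  (collect (nfPoly p)).flatMap (canonTermAV (minCornerP frame) frame)

theorem canonNFAV_eq (frame : List (Site 2)) (p : QPoly) : canonNFAV frame p = canonNF frame p := by
  unfold canonNFAV canonNF
  simp only [canonTermAV_eq, mkSite_minCornerP_eq]

/-- Executed form of `shardOKR`. -/
def shardOKRV (K : SymCertR) (c j : ℕ) (P : QPoly) : Bool :=
  psuppIn P K.frame && isZero (psub (canonNFAV K.frame (shardPolyAtR K c j)) P)

theorem shardOKRV_eq (K : SymCertR) (c j : ℕ) (P : QPoly) : shardOKRV K c j P = shardOKR K c j P := by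
  unfold shardOKRV shardOKR
  rw [canonNFAV_eq]

/-- Executed form of `ShardFactsR` (each conjunct is ONE `native_decide` on `shardOKRV`). -/
def ShardFactsRV (K : SymCertR) (c : ℕ) : ℕ → List QPoly → Prop
  | _, [] => True
  | j, P :: Ps => shardOKRV K c j P = true ∧ ShardFactsRV K c (j + 1) Ps

theorem shardFactsR_of_RV (K : SymCertR) (c : ℕ) : ∀ (j : ℕ) (Ps : List QPoly), ShardFactsRV K c j Ps → ShardFactsR K c j Ps
  | _, [], _ => trivial
  | j, P :: Ps, h => ⟨(shardOKRV_eq K c j P) ▸ h.1, shardFactsR_of_RV K c (j + 1) Ps h.2⟩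

/-- **Sharded R-replay, executed form**: the closing grammar of a real R-literal — `hwf`/`hRok`/`hlen` by one cheap
`native_decide` each, `hfacts := ⟨by native_decide, …, trivial⟩` (one per shard, `shardOKRV`), `hfin` by one. -/
theorem energyDensity_ge_of_shardsRV (K : SymCertR) (hwf : wellFormed K.expand = true)
    (hRok : K.gramR.all (gramBlockROK K.frame) = true) (c : ℕ) (Ps : List QPoly)
    (hlen : (shardPolysR K c).length = Ps.length) (hfacts : ShardFactsRV K c 0 Ps)
    (hfin : isZero (canonNFAV K.frame Ps.flatten) = true) :
    ((symValueR K : ℚ) : ℝ) ≤ energyDensityTT' 1 0 8 (7 / 8) :=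
  energyDensity_ge_of_shardsR K hwf hRok c Ps hlen (shardFactsR_of_RV K c 0 Ps hfacts) (by rwa [canonNFAV_eq] at hfin)

/-! ##### Kernel demo: `toyRCert` in three R-shards (base shard + one chunk per R-block) -/

/-- The partials of the demo: each shard's own canonical normal form (a lander ships literals). -/
def toyRPartials : List QPoly :=
  [canonNF toyRCert.frame (shardPolyAtR toyRCert 0 0), canonNF toyRCert.frame (shardPolyAtR toyRCert 0 1),
    canonNF toyRCert.frame (shardPolyAtR toyRCert 0 2)]

theorem toyR_len : (shardPolysR toyRCert 0).length = toyRPartials.length := by decide +kernel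

theorem toyR_facts : ShardFactsR toyRCert 0 0 toyRPartials := by
  unfold toyRPartials
  refine ⟨by decide +kernel, ?_⟩
  refine ⟨by decide +kernel, ?_⟩
  refine ⟨by decide +kernel, ?_⟩
  exact trivial

theorem toyR_final : isZero (canonNF toyRCert.frame toyRPartials.flatten) = true := by decide +kernel

theorem toyR_wf : wellFormed toyRCert.expand = true := by decide +kernel

theorem toyR_rok : toyRCert.gramR.all (gramBlockROK toyRCert.frame) = true := by decide +kernel

/-- The per-shard facts are not vacuous: no single shard of `toyRCert` closes on its own (only their sum does), and
the executed pipe agrees with T12b's on a shard. -/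
example : shardOKR toyRCert 0 0 [] = false ∧ shardOKR toyRCert 0 1 [] = false ∧ shardOKR toyRCert 0 2 [] = false := by
  decide +kernel

example : shardOKRV toyRCert 0 1 (canonNF toyRCert.frame (shardPolyAtR toyRCert 0 1)) = true := by decide +kernel

/-- **`toyRCert` replayed in SHARDS, end to end, no hypothesis**: `−11/4 ≤ e₀(1, 0, 8, 7/8)` again, this time through
`energyDensity_ge_of_shardsR` (standard axioms; `decide +kernel` only). -/
theorem toyRCert_energy_ge_sharded : (((-11) / 4 : ℚ) : ℝ) ≤ energyDensityTT' 1 0 8 (7 / 8) := by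
  have h := energyDensity_ge_of_shardsR toyRCert toyR_wf toyR_rok 0 toyRPartials toyR_len toyR_facts toyR_final
  rwa [show symValueR toyRCert = (-11) / 4 from toyRCert_value] at h

end ShardsR

end Summit.Ventures.CertifiedManyBodySolver.Theorems.SymReplay

end
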